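import Summits.CriticalPhenomena.PercolationContinuityZ3.Theorems.Transplant.FKConnectivityAllQPat3ThetaJoin
import HarnessLib

/-!
# Connectivity correlation inequalities for `φ_{w,q}`, every `q > 0` — THE THETA GLUING (Stage S2, part 1b): patterns, antipodal
# exponent and the TRILINEAR decomposition of a three-mark table over three two-terminal pieces in parallel

Theorems file (`--supports stmt-CriticalPhenomena-4575`), census lane `prim-bschramm-census` (gen 36) of the post-continuity programme (LANE 2 bschramm, FK sub-lane);
builds on p205010 (kernel theorem, internal audit signed; external expert review pending).
No definitions, no named facts, no sorries; standard axioms.  For the THETA configuration (`…Pat3ThetaJoin.lean`):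
`FK.reach_uv_union3`, `FK.reach_mark_union3`, **`FK.pat3_union3_theta`** (`pat (γ_K ∪ γ₁ ∪ γ₂) b s t = join3` of the pieces'
patterns on `(u, v, own mark)`), **`FK.apExp_union3_theta`** (`k+k̄+4|V| = Σ_p (k+k̄)_p + corr3 + corr3'`, fk-2's `apExp_parallel`
twice), **`FK.tval_union3_theta`** (census g32's "r-linear form" for `r = 3`: `tval` on `G` with weight `w(·+4|V|)` = the sum over
configuration triples of `w(Σ exponents + corr3 + corr3') · tab(join3 patterns, join3 complement patterns)`).  What remains for
Stage S2 of census g35's blueprint: the RING (triangle) configuration, the levelwise product-cone lemma (PROOF-THEOREM-SP §2.2) over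
these decompositions, a reflective certificate checker, and the certificate data (THETA_TS 111 / THETA_STAR 191 / RING_TS 179 /
RING_STAR 157 products) — all generators (𝒯₁, 𝒯₂, U-rectangles) being in table form already.
[cite: AyyerLinussonRavichandran2025, §7 eq. (13)–(15) (p. 22)] [cite: Grimmett2006, §3.8 (pp. 61–62)]
-/

noncomputable section

namespace Summit.CriticalPhenomena.PercolationContinuityZ3.Theorems

namespace FK

open SimpleGraph Literature.Probability.LatticeModels Literature.Probability.Percolation

open scoped Classical

variable {V : Type*}

section Theta

variable {EK E₁ E₂ : Finset (Sym2 V)} {VK V₁ V₂ : Set V} {u v : V}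

/-- **`u ~ v` across a THETA gluing** iff inside one of the three pieces. [folklore] -/
theorem reach_uv_union3 (hK : ∀ e ∈ (↑EK : Set (Sym2 V)), ∀ z ∈ e, z ∈ VK)
    (h₁ : ∀ e ∈ (↑E₁ : Set (Sym2 V)), ∀ z ∈ e, z ∈ V₁) (h₂ : ∀ e ∈ (↑E₂ : Set (Sym2 V)), ∀ z ∈ e, z ∈ V₂)
    (hK1 : VK ∩ V₁ ⊆ ({u, v} : Set V)) (hK2 : VK ∩ V₂ ⊆ ({u, v} : Set V)) (h12 : V₁ ∩ V₂ ⊆ ({u, v} : Set V))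
    {γK γ₁ γ₂ : Finset (Sym2 V)} (gK : γK ⊆ EK) (g₁ : γ₁ ⊆ E₁) (g₂ : γ₂ ⊆ E₂) :
    (openGraph (↑(γK ∪ γ₁ ∪ γ₂) : BondConfig V)).Reachable u v ↔
      (openGraph (↑γK : BondConfig V)).Reachable u v ∨ (openGraph (↑γ₁ : BondConfig V)).Reachable u v ∨
        (openGraph (↑γ₂ : BondConfig V)).Reachable u v := by
  rw [reachable_union_parallel (edges_union_verts hK h₁) h₂ (union_inter_subset_pair' hK2 h12)
      (Finset.union_subset_union gK g₁) g₂,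
    reachable_union_parallel hK h₁ hK1 gK g₁, or_assoc]

/-- **A mark reaches a corner across a THETA gluing** iff it does inside its own piece, or it reaches the other corner inside
its piece and the corners are joined (in some piece).  Stated for the corner `u` and the mark `t` of the third piece; the other
five cases follow by permuting the pieces and exchanging the corners. [folklore] -/
theorem reach_mark_union3 (hK : ∀ e ∈ (↑EK : Set (Sym2 V)), ∀ z ∈ e, z ∈ VK)
    (h₁ : ∀ e ∈ (↑E₁ : Set (Sym2 V)), ∀ z ∈ e, z ∈ V₁) (h₂ : ∀ e ∈ (↑E₂ : Set (Sym2 V)), ∀ z ∈ e, z ∈ V₂)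
    (hK1 : VK ∩ V₁ ⊆ ({u, v} : Set V)) (hK2 : VK ∩ V₂ ⊆ ({u, v} : Set V)) (h12 : V₁ ∩ V₂ ⊆ ({u, v} : Set V)) {t : V}
    (htK : t ∉ VK) (ht1 : t ∉ V₁) (htu : t ≠ u) (htv : t ≠ v)
    {γK γ₁ γ₂ : Finset (Sym2 V)} (gK : γK ⊆ EK) (g₁ : γ₁ ⊆ E₁) (g₂ : γ₂ ⊆ E₂) :
    (openGraph (↑(γK ∪ γ₁ ∪ γ₂) : BondConfig V)).Reachable u t ↔
      (openGraph (↑γ₂ : BondConfig V)).Reachable u t ∨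
        (((openGraph (↑γK : BondConfig V)).Reachable u v ∨ (openGraph (↑γ₁ : BondConfig V)).Reachable u v ∨
            (openGraph (↑γ₂ : BondConfig V)).Reachable u v) ∧ (openGraph (↑γ₂ : BondConfig V)).Reachable v t) := by
  have ht : t ∉ VK ∪ V₁ := fun h => h.elim htK ht1
  rw [reachable_union_par_third (edges_union_verts hK h₁) h₂ (union_inter_subset_pair' hK2 h12) ht htu htv
      (Finset.union_subset_union gK g₁) g₂,
    reachable_union_parallel hK h₁ hK1 gK g₁, or_assoc]

/-- **PATTERN GLUING FOR THE THETA CONFIGURATION** (census g34 Lemma Θ₃ / g32 §2.1): for three pieces `K ∋ b`, `Q₁ ∋ s`,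
`Q₂ ∋ t` (marks off the other pieces and off the corners) glued in parallel between the corners `u, v` (pairwise interfaces
inside `{u, v}`), the pattern of `γ_K ∪ γ₁ ∪ γ₂` on `(b, s, t)` is `join3` of the pieces' patterns on `(u, v, b)`, `(u, v, s)`,
`(u, v, t)`. [folklore] -/
theorem pat3_union3_theta (hK : ∀ e ∈ (↑EK : Set (Sym2 V)), ∀ z ∈ e, z ∈ VK)
    (h₁ : ∀ e ∈ (↑E₁ : Set (Sym2 V)), ∀ z ∈ e, z ∈ V₁) (h₂ : ∀ e ∈ (↑E₂ : Set (Sym2 V)), ∀ z ∈ e, z ∈ V₂)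
    (hK1 : VK ∩ V₁ ⊆ ({u, v} : Set V)) (hK2 : VK ∩ V₂ ⊆ ({u, v} : Set V)) (h12 : V₁ ∩ V₂ ⊆ ({u, v} : Set V)) {b s t : V}
    (hb1 : b ∉ V₁) (hb2 : b ∉ V₂) (hsK : s ∉ VK) (hs2 : s ∉ V₂) (htK : t ∉ VK) (ht1 : t ∉ V₁)
    (hbu : b ≠ u) (hbv : b ≠ v) (hsu : s ≠ u) (hsv : s ≠ v) (htu : t ≠ u) (htv : t ≠ v)
    (hbs : b ≠ s) (hbt : b ≠ t) (hst : s ≠ t)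
    {γK γ₁ γ₂ : Finset (Sym2 V)} (gK : γK ⊆ EK) (g₁ : γ₁ ⊆ E₁) (g₂ : γ₂ ⊆ E₂) :
    pat3 (γK ∪ γ₁ ∪ γ₂) b s t = join3 (pat3 γK u v b) (pat3 γ₁ u v s) (pat3 γ₂ u v t) := by
  have hK1' : V₁ ∩ VK ⊆ ({u, v} : Set V) := fun z hz => hK1 ⟨hz.2, hz.1⟩
  have hK2' : V₂ ∩ VK ⊆ ({u, v} : Set V) := fun z hz => hK2 ⟨hz.2, hz.1⟩
  have h12' : V₂ ∩ V₁ ⊆ ({u, v} : Set V) := fun z hz => h12 ⟨hz.2, hz.1⟩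
  have pc : ({v, u} : Set V) = {u, v} := Set.pair_comm _ _
  -- `u ~ v`
  have euv := reach_uv_union3 hK h₁ h₂ hK1 hK2 h12 gK g₁ g₂
  -- the six mark/corner relations
  have e_ut := reach_mark_union3 hK h₁ h₂ hK1 hK2 h12 htK ht1 htu htv gK g₁ g₂
  have e_vt := reach_mark_union3 (u := v) (v := u) hK h₁ h₂ (by rwa [pc]) (by rwa [pc]) (by rwa [pc]) htK ht1 htv htu gK g₁ g₂
  have e_us := reach_mark_union3 hK h₂ h₁ hK2 hK1 h12' hsK hs2 hsu hsv gK g₂ g₁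
  rw [Finset.union_assoc, Finset.union_comm γ₂, ← Finset.union_assoc] at e_us
  have e_vs := reach_mark_union3 (u := v) (v := u) hK h₂ h₁ (by rwa [pc]) (by rwa [pc]) (by rwa [pc]) hsK hs2 hsv hsu gK g₂ g₁
  rw [Finset.union_assoc, Finset.union_comm γ₂, ← Finset.union_assoc] at e_vs
  have e_ub := reach_mark_union3 h₁ h₂ hK h12 hK1' hK2' hb1 hb2 hbu hbv g₁ g₂ gK
  rw [Finset.union_comm (γ₁ ∪ γ₂), ← Finset.union_assoc] at e_ub
  have e_vb := reach_mark_union3 (u := v) (v := u) h₁ h₂ hK (by rwa [pc]) (by rwa [pc]) (by rwa [pc]) hb1 hb2 hbv hbu g₁ g₂ gK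
  rw [Finset.union_comm (γ₁ ∪ γ₂), ← Finset.union_assoc] at e_vb
  have hVB : ∀ e ∈ (↑(E₁ ∪ E₂) : Set (Sym2 V)), ∀ z ∈ e, z ∈ V₁ ∪ V₂ := edges_union_verts h₁ h₂
  have hSB : VK ∩ (V₁ ∪ V₂) ⊆ ({u, v} : Set V) := by
    rintro z ⟨hzK, hz | hz⟩
    · exact hK1 ⟨hzK, hz⟩
    · exact hK2 ⟨hzK, hz⟩
  have e_bs := reachable_union_marks hK hVB hSB (m := b) (m' := s) (fun h => h.elim hb1 hb2) hsK hbu hbv hbs gK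
      (Finset.union_subset_union g₁ g₂)
  rw [← Finset.union_assoc] at e_bs
  have e_bt := reachable_union_marks hK hVB hSB (m := b) (m' := t) (fun h => h.elim hb1 hb2) htK hbu hbv hbt gK
      (Finset.union_subset_union g₁ g₂)
  rw [← Finset.union_assoc] at e_bt
  have hVA' : ∀ e ∈ (↑(EK ∪ E₂) : Set (Sym2 V)), ∀ z ∈ e, z ∈ VK ∪ V₂ := edges_union_verts hK h₂
  have hS1 : V₁ ∩ (VK ∪ V₂) ⊆ ({u, v} : Set V) := by
    rintro z ⟨hz1, hz | hz⟩
    · exact hK1 ⟨hz, hz1⟩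
    · exact h12 ⟨hz1, hz⟩
  have e_st := reachable_union_marks h₁ hVA' hS1 (m := s) (m' := t) (fun h => h.elim hsK hs2) ht1 hsu hsv hst g₁
      (Finset.union_subset_union gK g₂)
  rw [← Finset.union_assoc, Finset.union_comm γ₁ γK] at e_st
  have bK1 := pat3_xy_iff γK u v b
  have bK2 := pat3_xs_iff γK u v b
  have bK3 := pat3_ys_iff γK u v b
  have b11 := pat3_xy_iff γ₁ u v s
  have b12 := pat3_xs_iff γ₁ u v s
  have b13 := pat3_ys_iff γ₁ u v s
  have b21 := pat3_xy_iff γ₂ u v t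
  have b22 := pat3_xs_iff γ₂ u v t
  have b23 := pat3_ys_iff γ₂ u v t
  have buv : uvBit (pat3 γK u v b) (pat3 γ₁ u v s) (pat3 γ₂ u v t) = true ↔
      (openGraph (↑γK : BondConfig V)).Reachable u v ∨ (openGraph (↑γ₁ : BondConfig V)).Reachable u v ∨
        (openGraph (↑γ₂ : BondConfig V)).Reachable u v := bool_or3_iff bK1 b11 b21
  -- the corners-joined proposition in the orders / orientations in which it occurs
  have p1 : ((openGraph (↑γK : BondConfig V)).Reachable u v ∨ (openGraph (↑γ₂ : BondConfig V)).Reachable u v ∨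
      (openGraph (↑γ₁ : BondConfig V)).Reachable u v) ↔ ((openGraph (↑γK : BondConfig V)).Reachable u v ∨
      (openGraph (↑γ₁ : BondConfig V)).Reachable u v ∨ (openGraph (↑γ₂ : BondConfig V)).Reachable u v) :=
    ⟨fun h => h.elim Or.inl fun h => h.elim (fun hc => Or.inr (Or.inr hc)) fun hb => Or.inr (Or.inl hb),
      fun h => h.elim Or.inl fun h => h.elim (fun hc => Or.inr (Or.inr hc)) fun hb => Or.inr (Or.inl hb)⟩
  have p2 : ((openGraph (↑γ₁ : BondConfig V)).Reachable u v ∨ (openGraph (↑γ₂ : BondConfig V)).Reachable u v ∨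
      (openGraph (↑γK : BondConfig V)).Reachable u v) ↔ ((openGraph (↑γK : BondConfig V)).Reachable u v ∨
      (openGraph (↑γ₁ : BondConfig V)).Reachable u v ∨ (openGraph (↑γ₂ : BondConfig V)).Reachable u v) :=
    ⟨fun h => h.elim (fun hb => Or.inr (Or.inl hb)) fun h => h.elim (fun hc => Or.inr (Or.inr hc)) Or.inl,
      fun h => h.elim (fun ha => Or.inr (Or.inr ha)) fun h => h.elim Or.inl fun hc => Or.inr (Or.inl hc)⟩
  have sK : (openGraph (↑γK : BondConfig V)).Reachable v u ↔ (openGraph (↑γK : BondConfig V)).Reachable u v :=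
    ⟨Reachable.symm, Reachable.symm⟩
  have s1 : (openGraph (↑γ₁ : BondConfig V)).Reachable v u ↔ (openGraph (↑γ₁ : BondConfig V)).Reachable u v :=
    ⟨Reachable.symm, Reachable.symm⟩
  have s2 : (openGraph (↑γ₂ : BondConfig V)).Reachable v u ↔ (openGraph (↑γ₂ : BondConfig V)).Reachable u v :=
    ⟨Reachable.symm, Reachable.symm⟩
  have q0 : ((openGraph (↑γK : BondConfig V)).Reachable v u ∨ (openGraph (↑γ₁ : BondConfig V)).Reachable v u ∨
      (openGraph (↑γ₂ : BondConfig V)).Reachable v u) ↔ ((openGraph (↑γK : BondConfig V)).Reachable u v ∨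
      (openGraph (↑γ₁ : BondConfig V)).Reachable u v ∨ (openGraph (↑γ₂ : BondConfig V)).Reachable u v) := by
    rw [sK, s1, s2]
  have q1 : ((openGraph (↑γK : BondConfig V)).Reachable v u ∨ (openGraph (↑γ₂ : BondConfig V)).Reachable v u ∨
      (openGraph (↑γ₁ : BondConfig V)).Reachable v u) ↔ ((openGraph (↑γK : BondConfig V)).Reachable u v ∨
      (openGraph (↑γ₁ : BondConfig V)).Reachable u v ∨ (openGraph (↑γ₂ : BondConfig V)).Reachable u v) := by
    rw [sK, s1, s2]; exact p1
  have q2 : ((openGraph (↑γ₁ : BondConfig V)).Reachable v u ∨ (openGraph (↑γ₂ : BondConfig V)).Reachable v u ∨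
      (openGraph (↑γK : BondConfig V)).Reachable v u) ↔ ((openGraph (↑γK : BondConfig V)).Reachable u v ∨
      (openGraph (↑γ₁ : BondConfig V)).Reachable u v ∨ (openGraph (↑γ₂ : BondConfig V)).Reachable u v) := by
    rw [sK, s1, s2]; exact p2
  have Xt := Pat3.toU_iff b22 b23 buv e_ut
  have Yt := Pat3.toV_iff b22 b23 (buv.trans q0.symm) e_vt
  have Xs := Pat3.toU_iff b12 b13 (buv.trans p1.symm) e_us
  have Ys := Pat3.toV_iff b12 b13 (buv.trans q1.symm) e_vs
  have Xb := Pat3.toU_iff bK2 bK3 (buv.trans p2.symm) e_ub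
  have Yb := Pat3.toV_iff bK2 bK3 (buv.trans q2.symm) e_vb
  -- reorient the mark/mark relations from the corners
  have E1 : (openGraph (↑(γK ∪ γ₁ ∪ γ₂) : BondConfig V)).Reachable b s ↔
      ((openGraph (↑(γK ∪ γ₁ ∪ γ₂) : BondConfig V)).Reachable u b ∧ (openGraph (↑(γK ∪ γ₁ ∪ γ₂) : BondConfig V)).Reachable u s) ∨
        ((openGraph (↑(γK ∪ γ₁ ∪ γ₂) : BondConfig V)).Reachable v b ∧ (openGraph (↑(γK ∪ γ₁ ∪ γ₂) : BondConfig V)).Reachable v s) := by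
    rw [e_bs]
    constructor
    · rintro (⟨h1, h2⟩ | ⟨h1, h2⟩)
      · exact Or.inl ⟨h1.symm, h2⟩
      · exact Or.inr ⟨h1.symm, h2⟩
    · rintro (⟨h1, h2⟩ | ⟨h1, h2⟩)
      · exact Or.inl ⟨h1.symm, h2⟩
      · exact Or.inr ⟨h1.symm, h2⟩
  have E2 : (openGraph (↑(γK ∪ γ₁ ∪ γ₂) : BondConfig V)).Reachable b t ↔
      ((openGraph (↑(γK ∪ γ₁ ∪ γ₂) : BondConfig V)).Reachable u b ∧ (openGraph (↑(γK ∪ γ₁ ∪ γ₂) : BondConfig V)).Reachable u t) ∨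
        ((openGraph (↑(γK ∪ γ₁ ∪ γ₂) : BondConfig V)).Reachable v b ∧ (openGraph (↑(γK ∪ γ₁ ∪ γ₂) : BondConfig V)).Reachable v t) := by
    rw [e_bt]
    constructor
    · rintro (⟨h1, h2⟩ | ⟨h1, h2⟩)
      · exact Or.inl ⟨h1.symm, h2⟩
      · exact Or.inr ⟨h1.symm, h2⟩
    · rintro (⟨h1, h2⟩ | ⟨h1, h2⟩)
      · exact Or.inl ⟨h1.symm, h2⟩
      · exact Or.inr ⟨h1.symm, h2⟩
  have E3 : (openGraph (↑(γK ∪ γ₁ ∪ γ₂) : BondConfig V)).Reachable s t ↔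
      ((openGraph (↑(γK ∪ γ₁ ∪ γ₂) : BondConfig V)).Reachable u s ∧ (openGraph (↑(γK ∪ γ₁ ∪ γ₂) : BondConfig V)).Reachable u t) ∨
        ((openGraph (↑(γK ∪ γ₁ ∪ γ₂) : BondConfig V)).Reachable v s ∧ (openGraph (↑(γK ∪ γ₁ ∪ γ₂) : BondConfig V)).Reachable v t) := by
    rw [e_st]
    constructor
    · rintro (⟨h1, h2⟩ | ⟨h1, h2⟩)
      · exact Or.inl ⟨h1.symm, h2⟩
      · exact Or.inr ⟨h1.symm, h2⟩
    · rintro (⟨h1, h2⟩ | ⟨h1, h2⟩)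
      · exact Or.inl ⟨h1.symm, h2⟩
      · exact Or.inr ⟨h1.symm, h2⟩
  rw [pat3_eq_ofBits]
  unfold join3
  have c1 := conn_iff (γK ∪ γ₁ ∪ γ₂) b s
  have c2 := conn_iff (γK ∪ γ₁ ∪ γ₂) b t
  have c3 := conn_iff (γK ∪ γ₁ ∪ γ₂) s t
  congr 1
  · exact Bool.eq_iff_iff.2 (c1.trans (E1.trans (bool_or_and_iff Xb Xs Yb Ys).symm))
  · exact Bool.eq_iff_iff.2 (c2.trans (E2.trans (bool_or_and_iff Xb Xt Yb Yt).symm))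
  · exact Bool.eq_iff_iff.2 (c3.trans (E3.trans (bool_or_and_iff Xs Xt Ys Yt).symm))

end Theta

/-! ### THETA gluing: the antipodal exponent and the trilinear decomposition -/


section ThetaExp

variable [Fintype V] {EK E₁ E₂ : Finset (Sym2 V)} {VK V₁ V₂ : Set V} {u v : V}

/-- **ANTIPODAL EXPONENT ACROSS A THETA GLUING**: `k(γ)+k(γᶜ)+4|V| = Σ_p (k(γ_p)+k(γ_pᶜ)) + corr3(patterns) + corr3(complement
patterns)` — fk-2's `FK.apExp_parallel` twice; the corrections are the cycle ranks `(#pieces joining u,v) − 1`. [folklore] -/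
theorem apExp_union3_theta (hdK1 : Disjoint EK E₁) (hdK2 : Disjoint EK E₂) (hd12 : Disjoint E₁ E₂)
    (hK : ∀ e ∈ (↑EK : Set (Sym2 V)), ∀ z ∈ e, z ∈ VK)
    (h₁ : ∀ e ∈ (↑E₁ : Set (Sym2 V)), ∀ z ∈ e, z ∈ V₁) (h₂ : ∀ e ∈ (↑E₂ : Set (Sym2 V)), ∀ z ∈ e, z ∈ V₂)
    (hK1 : VK ∩ V₁ ⊆ ({u, v} : Set V)) (hK2 : VK ∩ V₂ ⊆ ({u, v} : Set V)) (h12 : V₁ ∩ V₂ ⊆ ({u, v} : Set V)) (huv : u ≠ v)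
    (b s t : V) {γK γ₁ γ₂ : Finset (Sym2 V)} (gK : γK ⊆ EK) (g₁ : γ₁ ⊆ E₁) (g₂ : γ₂ ⊆ E₂) :
    apExp (EK ∪ E₁ ∪ E₂) (γK ∪ γ₁ ∪ γ₂) + 4 * Fintype.card V =
      apExp EK γK + apExp E₁ γ₁ + apExp E₂ γ₂ + corr3 (pat3 γK u v b) (pat3 γ₁ u v s) (pat3 γ₂ u v t) +
        corr3 (pat3 (EK \ γK) u v b) (pat3 (E₁ \ γ₁) u v s) (pat3 (E₂ \ γ₂) u v t) := by
  have hd : Disjoint (EK ∪ E₁) E₂ := Finset.disjoint_union_left.2 ⟨hdK2, hd12⟩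
  have e1 := apExp_parallel hdK1 hK h₁ hK1 huv le_rfl le_rfl gK g₁
  have e2 := apExp_parallel hd (edges_union_verts hK h₁) h₂ (union_inter_subset_pair' hK2 h12) huv le_rfl le_rfl
    (Finset.union_subset_union gK g₁) g₂
  rw [ite_prop_eq_ite_bool (p := (openGraph (↑γK : BondConfig V)).Reachable u v ∧ (openGraph (↑γ₁ : BondConfig V)).Reachable u v)
      (bb := (pat3 γK u v b).xy && (pat3 γ₁ u v s).xy) (by rw [Bool.and_eq_true, pat3_xy_iff, pat3_xy_iff]),
    ite_prop_eq_ite_bool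
      (p := (openGraph (↑(EK \ γK) : BondConfig V)).Reachable u v ∧ (openGraph (↑(E₁ \ γ₁) : BondConfig V)).Reachable u v)
      (bb := (pat3 (EK \ γK) u v b).xy && (pat3 (E₁ \ γ₁) u v s).xy) (by rw [Bool.and_eq_true, pat3_xy_iff, pat3_xy_iff])] at e1
  rw [ite_prop_eq_ite_bool
      (p := (openGraph (↑(γK ∪ γ₁) : BondConfig V)).Reachable u v ∧ (openGraph (↑γ₂ : BondConfig V)).Reachable u v)
      (bb := ((pat3 γK u v b).xy || (pat3 γ₁ u v s).xy) && (pat3 γ₂ u v t).xy)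
      (by rw [Bool.and_eq_true, Bool.or_eq_true, pat3_xy_iff, pat3_xy_iff, pat3_xy_iff, reachable_union_parallel hK h₁ hK1 gK g₁]),
    ite_prop_eq_ite_bool
      (p := (openGraph (↑((EK ∪ E₁) \ (γK ∪ γ₁)) : BondConfig V)).Reachable u v ∧
        (openGraph (↑(E₂ \ γ₂) : BondConfig V)).Reachable u v)
      (bb := ((pat3 (EK \ γK) u v b).xy || (pat3 (E₁ \ γ₁) u v s).xy) && (pat3 (E₂ \ γ₂) u v t).xy)
      (by rw [Bool.and_eq_true, Bool.or_eq_true, pat3_xy_iff, pat3_xy_iff, pat3_xy_iff, union_sdiff_union hdK1 gK g₁,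
        reachable_union_parallel hK h₁ hK1 Finset.sdiff_subset Finset.sdiff_subset])] at e2
  unfold corr3
  omega

/-- **TRILINEAR DECOMPOSITION OF `tval` OVER A THETA GLUING** (census g32 §2.1, "the r-linear form" for `r = 3`): the
weighted evaluation of a table on `(E_K ∪ E₁ ∪ E₂; b, s, t)` is the sum over triples of configurations of the pieces of
`w(Σ exponents + corr3 + corr3') · tab(join3 patterns, join3 complement patterns)`. [folklore] -/
theorem tval_union3_theta (hdK1 : Disjoint EK E₁) (hdK2 : Disjoint EK E₂) (hd12 : Disjoint E₁ E₂)
    (hK : ∀ e ∈ (↑EK : Set (Sym2 V)), ∀ z ∈ e, z ∈ VK)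
    (h₁ : ∀ e ∈ (↑E₁ : Set (Sym2 V)), ∀ z ∈ e, z ∈ V₁) (h₂ : ∀ e ∈ (↑E₂ : Set (Sym2 V)), ∀ z ∈ e, z ∈ V₂)
    (hK1 : VK ∩ V₁ ⊆ ({u, v} : Set V)) (hK2 : VK ∩ V₂ ⊆ ({u, v} : Set V)) (h12 : V₁ ∩ V₂ ⊆ ({u, v} : Set V)) (huv : u ≠ v)
    {b s t : V} (hb1 : b ∉ V₁) (hb2 : b ∉ V₂) (hsK : s ∉ VK) (hs2 : s ∉ V₂) (htK : t ∉ VK) (ht1 : t ∉ V₁)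
    (hbu : b ≠ u) (hbv : b ≠ v) (hsu : s ≠ u) (hsv : s ≠ v) (htu : t ≠ u) (htv : t ≠ v)
    (hbs : b ≠ s) (hbt : b ≠ t) (hst : s ≠ t) (w : ℕ → ℝ) (tab : Pat3 → Pat3 → ℤ) :
    tval (fun n => w (n + 4 * Fintype.card V)) (EK ∪ E₁ ∪ E₂) b s t tab =
      ∑ γK ∈ EK.powerset, ∑ γ₁ ∈ E₁.powerset, ∑ γ₂ ∈ E₂.powerset,
        w (apExp EK γK + apExp E₁ γ₁ + apExp E₂ γ₂ + corr3 (pat3 γK u v b) (pat3 γ₁ u v s) (pat3 γ₂ u v t) +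
            corr3 (pat3 (EK \ γK) u v b) (pat3 (E₁ \ γ₁) u v s) (pat3 (E₂ \ γ₂) u v t)) *
          (tab (join3 (pat3 γK u v b) (pat3 γ₁ u v s) (pat3 γ₂ u v t))
            (join3 (pat3 (EK \ γK) u v b) (pat3 (E₁ \ γ₁) u v s) (pat3 (E₂ \ γ₂) u v t)) : ℝ) := by
  have hd : Disjoint (EK ∪ E₁) E₂ := Finset.disjoint_union_left.2 ⟨hdK2, hd12⟩
  unfold tval
  beta_reduce
  rw [sum_powerset_union_disj hd]
  rw [sum_powerset_union_disj hdK1]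
  refine Finset.sum_congr rfl fun γK hγK => Finset.sum_congr rfl fun γ₁ hγ₁ => Finset.sum_congr rfl fun γ₂ hγ₂ => ?_
  have gK := Finset.mem_powerset.1 hγK
  have g₁ := Finset.mem_powerset.1 hγ₁
  have g₂ := Finset.mem_powerset.1 hγ₂
  rw [union_sdiff_union hd (Finset.union_subset_union gK g₁) g₂, union_sdiff_union hdK1 gK g₁,
    apExp_union3_theta hdK1 hdK2 hd12 hK h₁ h₂ hK1 hK2 h12 huv b s t gK g₁ g₂,
    pat3_union3_theta hK h₁ h₂ hK1 hK2 h12 hb1 hb2 hsK hs2 htK ht1 hbu hbv hsu hsv htu htv hbs hbt hst gK g₁ g₂,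
    pat3_union3_theta hK h₁ h₂ hK1 hK2 h12 hb1 hb2 hsK hs2 htK ht1 hbu hbv hsu hsv htu htv hbs hbt hst
      Finset.sdiff_subset Finset.sdiff_subset Finset.sdiff_subset]

end ThetaExp

end FK

end Summit.CriticalPhenomena.PercolationContinuityZ3.Theorems

end
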